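import Summits.BirchSwinnertonDyer.BirchSwinnertonDyer.Theorems.KatoDescentPotSupersingularReducibleFineSelmerBorelCyclotomic
import Literature.NumberTheory.EllipticCurves.DivisionFieldReducibleBorelCyclotomic
import HarnessLib

/-!
# Coates–Sujatha's statement (A) at `p` for every `E/ℚ` with a rational point of order `p ∈ {3, 5}` (a non-zero
# `Γ_ℚ`-fixed point of `E[p]`) — FACT-FREE
# (and at any odd `p` with `p ∤ h(ℚ(μ_p))`, for every line of `E[p]` fixed by `Gal(ℚ̄/ℚ(μ_p))`)

Seat `bsd-potss-rkm` g35 (prover; cell `bsd-potss`), item stmt-BirchSwinnertonDyer-19196 `ReducibleKatoMember` = crux M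
of the routes K9 `KatoDescentPotSupersingular` / K8-t′ `KatoDescentTamePotSupersingular` (`--supports`, helper; closes
nothing).  HONEST FRAMING (cell): BSD is not proved by any of this; nothing is booked; crux M stays cite-level; the
class-wide trust base of M is unchanged — this file removes Ferrero–Washington from it on an explicit FAMILY of rows.

WHAT.  The prequel `…ReducibleFineSelmerBorelCyclotomic` (this seat) proves (A) on a reducible row from the hypothesis
`W.borelField C ≤ L` (`L ⊆ ℚ̄` a `p`-th cyclotomic field with `p ∤ h(L)`); the Literature bridge
`DivisionFieldReducibleBorelCyclotomic` (this seat; the tree's PROVED Weil pairing, AEC III.8.1) supplies that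
hypothesis whenever `Gal(ℚ̄/L)` fixes the line `C` pointwise (`χ₂ = ω χ₁⁻¹`).  Composing:

* `fineSelmerDual_moduleFinite_of_forall_mem_fixingSubgroup_smul_eq` — `E/ℚ`, `p` odd, `κ` cyclotomic, `C` a stable
  line of `E[p]` fixed pointwise by `Gal(ℚ̄/L)`, `p ∤ #Cl(𝓞 L)`: (A).  FACT-FREE (regularity displayed).
* `fineSelmerDual_moduleFinite_of_fixed_line` — `C` fixed pointwise by ALL of `Γ_ℚ` (a line of RATIONAL `p`-torsion):
  (A), for any `p`-th cyclotomic `L ⊆ ℚ̄` with `p ∤ #Cl(𝓞 L)`.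
* `fineSelmerDual_moduleFinite_three_of_fixed_line`, `…_five_…` — NOTHING displayed (`h(ℚ(μ_3)) = h(ℚ(μ_5)) = 1`, Mathlib).
* **`fineSelmerDual_moduleFinite_three_of_fixed_point` / `…_five_of_fixed_point`** — for EVERY elliptic `W/ℚ` with a
  non-zero `Γ_ℚ`-FIXED point `Q ∈ W[3](ℚ̄)` (resp. `W[5](ℚ̄)`) — by Galois descent exactly a RATIONAL point of order `3`
  (resp. `5`) — and every cyclotomic `ℤ_3`- (resp. `ℤ_5`-) extension: the dual fine Selmer group of `W` over `ℚ_cyc` is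
  finitely generated over `ℤ_p` — Coates–Sujatha's Conjecture A for this family, with NO named fact (in print:
  Coates–Sujatha 2005 Cor. 3.6 with Ferrero–Washington; here: Iwasawa 1956 at `ℚ(μ_p)` + Weil pairing).
* `nonempty_coreInputs_of_fineInputs_three_of_fixed_point` — crux M's per-pin core package at such a row at `p = 3` from
  Kato's inputs (hull sub-package, H2X⁺ data) and NOTHING ELSE.

References: [CoatesSujatha2005] Thm. 3.4, Cor. 3.6; [Greenberg2001IwasawaPastPresent] Prop. 2.1, p. 342; [SilvermanAEC2009]
Prop. III.8.1; [Wuthrich2014] Lemma 14 (p. 396); [Kato2004Asterisque] Thm. 12.5 (pp. 221–222), §14.14 (p. 243).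
-/

-- the summit and its single problem are both named `BirchSwinnertonDyer` (registry layout D-0017)
set_option linter.dupNamespace false
set_option autoImplicit false

noncomputable section

open scoped Classical NumberField

namespace Summit.BirchSwinnertonDyer.BirchSwinnertonDyer.Theorems.ReducibleFineSelmerRationalTorsion

open NumberField IsDedekindDomain Field WeierstrassCurve IntermediateField
open Literature.NumberTheory.EllipticCurves Literature.NumberTheory.EllipticCurves.GreenbergSelmer
  Literature.NumberTheory.GaloisRepresentations Literature.NumberTheory.IwasawaTheory
  Literature.NumberTheory.EllipticCurves.Kato2004 Literature.NumberTheory.EllipticCurves.IwasawaAlgebra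
  Summit.BirchSwinnertonDyer.BirchSwinnertonDyer.Theorems

/-! ## §0 Transport of `IsCyclotomicExtension {p} ℚ L` between the two `ℚ`-algebra structures on `L ⊆ ℚ̄` -/

/-- The Literature bridge is stated over a general base `K` with the `IntermediateField` algebra structure on `L`; over
`ℚ` the default instance is `algebraRat`.  The two `ℚ`-algebra structures agree (`Subsingleton (Algebra ℚ L)`), so the
cyclotomic predicate transports. [folklore] -/
theorem isCyclotomicExtension_rat_transport {S : Set ℕ} {L : Type} [Field L]
    {i₁ : Algebra ℚ L} (i₂ : Algebra ℚ L) (h : @IsCyclotomicExtension S ℚ L _ _ i₁) :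
    @IsCyclotomicExtension S ℚ L _ _ i₂ := by
  obtain rfl : i₁ = i₂ := Subsingleton.elim _ _
  exact h

/-! ## §1 Lines fixed by `Gal(ℚ̄/ℚ(μ_p))` -/

/-- **(A) on a reducible row whose stable line is fixed pointwise by `Gal(ℚ̄/L)`, `L ⊆ ℚ̄` a `p`-th cyclotomic field with
`p ∤ #Cl(𝓞 L)` — FACT-FREE** (the prequel's cyclotomic-Borel door with `W.borelField C ≤ L` supplied by the Weil-pairing
bridge `borelField_le_of_forall_mem_fixingSubgroup_smul_eq`). [cite: CoatesSujatha2005, Cor. 3.6]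
[cite: Greenberg2001IwasawaPastPresent, Prop. 2.1 p. 339 and p. 342] [cite: SilvermanAEC2009, Prop. III.8.1] -/
theorem fineSelmerDual_moduleFinite_of_forall_mem_fixingSubgroup_smul_eq
    (W : WeierstrassCurve ℚ) [W.IsElliptic] (p : ℕ) [Fact p.Prime] (hp : p ≠ 2)
    (κ : ZpExtension ℚ p) (hκ : κ.IsCyclotomic)
    (C : AddSubgroup (W.geomTorsion (p : ℤ)))
    (hC : ∀ (σ : absoluteGaloisGroup ℚ) (x : W.geomTorsion (p : ℤ)), x ∈ C → σ • x ∈ C)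
    (h1 : C ≠ ⊥) (h2 : C ≠ ⊤)
    (L : IntermediateField ℚ (AlgebraicClosure ℚ)) [IsCyclotomicExtension {p} ℚ L]
    (hCL : ∀ σ : absoluteGaloisGroup ℚ, σ ∈ (L.fixingSubgroup : Subgroup (absoluteGaloisGroup ℚ)) →
      ∀ x : W.geomTorsion (p : ℤ), x ∈ C → σ • x = x)
    (hreg : ¬ p ∣ Nat.card (ClassGroup (𝓞 L))) :
    ∃ (γ : Field.absoluteGaloisGroup ℚ) (D : W.FineSelmerDualData κ γ),
      Module.Finite ℤ_[p] (RestrictScalars ℤ_[p] (IwasawaAlgebra p) D.X) := by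
  -- the bridge is stated over a general base `K` with the `IntermediateField` algebra structure on `L`; over `ℚ` the
  -- default `ℚ`-algebra instance is `algebraRat` — the two agree (`Subsingleton (Algebra ℚ L)`), `convert` transports
  have hB : W.borelField C ≤ L :=
    @WeierstrassCurve.borelField_le_of_forall_mem_fixingSubgroup_smul_eq ℚ _ _ W p _ _ C h1 h2 L
      (isCyclotomicExtension_rat_transport _ ‹IsCyclotomicExtension {p} ℚ ↥L›) hCL
  exact ReducibleFineSelmerBorelCyclotomic.fineSelmerDual_moduleFinite_of_borelField_le_cyclotomic W p hp κ hκ C hC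
    h1 h2 L hB hreg

/-- **(A) on a row with a line of RATIONAL `p`-torsion** (`C` fixed pointwise by `Γ_ℚ`; `L ⊆ ℚ̄` any `p`-th cyclotomic field
with `p ∤ #Cl(𝓞 L)`) — FACT-FREE. [cite: CoatesSujatha2005, Cor. 3.6] [cite: Greenberg2001IwasawaPastPresent, p. 342]
[cite: SilvermanAEC2009, Prop. III.8.1] -/
theorem fineSelmerDual_moduleFinite_of_fixed_line
    (W : WeierstrassCurve ℚ) [W.IsElliptic] (p : ℕ) [Fact p.Prime] (hp : p ≠ 2)
    (κ : ZpExtension ℚ p) (hκ : κ.IsCyclotomic)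
    (C : AddSubgroup (W.geomTorsion (p : ℤ))) (h1 : C ≠ ⊥) (h2 : C ≠ ⊤)
    (hfix : ∀ (σ : absoluteGaloisGroup ℚ) (x : W.geomTorsion (p : ℤ)), x ∈ C → σ • x = x)
    (L : IntermediateField ℚ (AlgebraicClosure ℚ)) [IsCyclotomicExtension {p} ℚ L]
    (hreg : ¬ p ∣ Nat.card (ClassGroup (𝓞 L))) :
    ∃ (γ : Field.absoluteGaloisGroup ℚ) (D : W.FineSelmerDualData κ γ),
      Module.Finite ℤ_[p] (RestrictScalars ℤ_[p] (IwasawaAlgebra p) D.X) :=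
  fineSelmerDual_moduleFinite_of_forall_mem_fixingSubgroup_smul_eq W p hp κ hκ C
    (fun σ x hx => by rw [hfix σ x hx]; exact hx) h1 h2 L (fun σ _ x hx => hfix σ x hx) hreg

/-- **(A) at `p = 3` for every `E/ℚ` with a line of `E[3]` fixed pointwise by `Γ_ℚ` — NOTHING displayed** (`ℚ(ζ_3) ⊆ ℚ̄`
exists and has class number `1`). [cite: CoatesSujatha2005, Cor. 3.6] [cite: Greenberg2001IwasawaPastPresent, p. 342] -/
theorem fineSelmerDual_moduleFinite_three_of_fixed_line
    (W : WeierstrassCurve ℚ) [W.IsElliptic] [Fact (3 : ℕ).Prime]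
    (κ : ZpExtension ℚ 3) (hκ : κ.IsCyclotomic)
    (C : AddSubgroup (W.geomTorsion ((3 : ℕ) : ℤ))) (h1 : C ≠ ⊥) (h2 : C ≠ ⊤)
    (hfix : ∀ (σ : absoluteGaloisGroup ℚ) (x : W.geomTorsion ((3 : ℕ) : ℤ)), x ∈ C → σ • x = x) :
    ∃ (γ : Field.absoluteGaloisGroup ℚ) (D : W.FineSelmerDualData κ γ),
      Module.Finite ℤ_[3] (RestrictScalars ℤ_[3] (IwasawaAlgebra 3) D.X) := by
  obtain ⟨L, hL⟩ := WeierstrassCurve.exists_isCyclotomicExtension_intermediateField (K := ℚ) (p := 3)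
  have hB : W.borelField C ≤ L := @WeierstrassCurve.borelField_le_of_forall_smul_eq ℚ _ _ W 3 _ _ C h1 h2 hfix L hL
  haveI : IsCyclotomicExtension {3} ℚ ↥L := isCyclotomicExtension_rat_transport _ hL
  exact ReducibleFineSelmerBorelCyclotomic.fineSelmerDual_moduleFinite_of_borelField_le_cyclotomic_three W κ hκ C
    (fun σ x hx => by rw [hfix σ x hx]; exact hx) h1 h2 L hB

/-- **(A) at `p = 5` for every `E/ℚ` with a line of `E[5]` fixed pointwise by `Γ_ℚ` — NOTHING displayed.**
[cite: CoatesSujatha2005, Cor. 3.6] [cite: Greenberg2001IwasawaPastPresent, p. 342] -/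
theorem fineSelmerDual_moduleFinite_five_of_fixed_line
    (W : WeierstrassCurve ℚ) [W.IsElliptic] [Fact (5 : ℕ).Prime]
    (κ : ZpExtension ℚ 5) (hκ : κ.IsCyclotomic)
    (C : AddSubgroup (W.geomTorsion ((5 : ℕ) : ℤ))) (h1 : C ≠ ⊥) (h2 : C ≠ ⊤)
    (hfix : ∀ (σ : absoluteGaloisGroup ℚ) (x : W.geomTorsion ((5 : ℕ) : ℤ)), x ∈ C → σ • x = x) :
    ∃ (γ : Field.absoluteGaloisGroup ℚ) (D : W.FineSelmerDualData κ γ),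
      Module.Finite ℤ_[5] (RestrictScalars ℤ_[5] (IwasawaAlgebra 5) D.X) := by
  obtain ⟨L, hL⟩ := WeierstrassCurve.exists_isCyclotomicExtension_intermediateField (K := ℚ) (p := 5)
  have hB : W.borelField C ≤ L := @WeierstrassCurve.borelField_le_of_forall_smul_eq ℚ _ _ W 5 _ _ C h1 h2 hfix L hL
  haveI : IsCyclotomicExtension {5} ℚ ↥L := isCyclotomicExtension_rat_transport _ hL
  exact ReducibleFineSelmerBorelCyclotomic.fineSelmerDual_moduleFinite_of_borelField_le_cyclotomic_five W κ hκ C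
    (fun σ x hx => by rw [hfix σ x hx]; exact hx) h1 h2 L hB

/-! ## §2 The line generated by a non-zero `Γ_ℚ`-fixed point of `E[p]` (a rational point of order `p`) -/

section FixedPoint

variable (W : WeierstrassCurve ℚ) [W.IsElliptic] {p : ℕ} [hp : Fact p.Prime]

/-- **The line `ℤQ ≤ E[p]` of a non-zero `Γ_ℚ`-fixed `Q ∈ E[p]`: non-zero, proper, fixed pointwise by `Γ_ℚ`.**  (By Galois
descent — the tree's `exists_toGeomPoints_eq_of_forall_smul_eq` — such a `Q` is exactly the image of a rational point of
order `p`.) [cite: SilvermanAEC2009, VIII.§1 (E(K) ⊂ E(K̄) fixed by Galois), Cor. III.6.4 (b)] -/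
theorem exists_fixed_line_of_fixed_point (Q : W.geomTorsion (p : ℤ)) (hQ0 : Q ≠ 0)
    (hQfix : ∀ σ : absoluteGaloisGroup ℚ, σ • Q = Q) :
    ∃ C : AddSubgroup (W.geomTorsion (p : ℤ)), C ≠ ⊥ ∧ C ≠ ⊤ ∧
      ∀ (σ : absoluteGaloisGroup ℚ) (x : W.geomTorsion (p : ℤ)), x ∈ C → σ • x = x := by
  have hpr : p.Prime := hp.out
  refine ⟨AddSubgroup.zmultiples Q, ?_, ?_, ?_⟩
  · rw [Ne, AddSubgroup.zmultiples_eq_bot]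
    exact hQ0
  · -- `#ℤQ ∣ p < p² = #E[p]`
    intro htop
    have hV : Nat.card (W.geomTorsion (p : ℤ)) = p ^ 2 := W.natCard_geomTorsion_eq_sq_of_charZero hpr
    have hQp : p • Q = 0 := by
      apply Subtype.ext
      rw [AddSubgroupClass.coe_nsmul, ZeroMemClass.coe_zero, ← natCast_zsmul]
      exact (Submodule.mem_torsionBy_iff (p : ℤ) _).mp Q.2
    have hord : addOrderOf Q ∣ p := addOrderOf_dvd_of_nsmul_eq_zero hQp
    have hcard : Nat.card (AddSubgroup.zmultiples Q) = addOrderOf Q := Nat.card_zmultiples Q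
    have htop' : Nat.card (AddSubgroup.zmultiples Q) = p ^ 2 := by
      rw [htop, ← hV]
      exact Nat.card_congr AddSubgroup.topEquiv.toEquiv
    rw [hcard] at htop'
    rw [htop'] at hord
    have h1 : p ^ 2 ≤ p := Nat.le_of_dvd hpr.pos hord
    have h2 : p < p ^ 2 := by nlinarith [hpr.one_lt]
    omega
  · intro σ x hx
    obtain ⟨k, rfl⟩ := AddSubgroup.mem_zmultiples_iff.mp hx
    rw [show σ • (k • Q) = k • (σ • Q) from map_zsmul (DistribSMul.toAddMonoidHom _ σ) k Q, hQfix]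

end FixedPoint

/-- **Coates–Sujatha's (A) at `p = 3` for EVERY elliptic curve over `ℚ` with a rational point of order `3` — FACT-FREE.**
For `W/ℚ` elliptic, a non-zero `Γ_ℚ`-fixed `Q ∈ W[3](ℚ̄)` (= a rational point of order `3`), and every cyclotomic
`ℤ_3`-extension `κ` of `ℚ`: the Pontryagin dual of the fine Selmer group of `W` over `ℚ_cyc` is finitely generated over
`ℤ_3` (`∃ γ D, Module.Finite ℤ_[3] D.X`).  Inputs, all kernel theorems: g33's dévissage over the Borel field, the character
form of Iwasawa's `μ = 0` (g34), Iwasawa 1956 at `ℚ(μ_3)` (`h = 1`, Mathlib `three_pid`) descended to the Borel field, and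
`χ₂ = ω` from the Weil pairing.  In print: Coates–Sujatha 2005 Cor. 3.6 (with Ferrero–Washington).
[cite: CoatesSujatha2005, Cor. 3.6] [cite: Greenberg2001IwasawaPastPresent, Prop. 2.1 p. 339 and p. 342]
[cite: SilvermanAEC2009, Prop. III.8.1] -/
theorem fineSelmerDual_moduleFinite_three_of_fixed_point
    (W : WeierstrassCurve ℚ) [W.IsElliptic] [Fact (3 : ℕ).Prime]
    (Q : W.geomTorsion ((3 : ℕ) : ℤ)) (hQ0 : Q ≠ 0) (hQfix : ∀ σ : absoluteGaloisGroup ℚ, σ • Q = Q)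
    (κ : ZpExtension ℚ 3) (hκ : κ.IsCyclotomic) :
    ∃ (γ : Field.absoluteGaloisGroup ℚ) (D : W.FineSelmerDualData κ γ),
      Module.Finite ℤ_[3] (RestrictScalars ℤ_[3] (IwasawaAlgebra 3) D.X) := by
  obtain ⟨C, h1, h2, hfix⟩ := exists_fixed_line_of_fixed_point W Q hQ0 hQfix
  exact fineSelmerDual_moduleFinite_three_of_fixed_line W κ hκ C h1 h2 hfix

/-- **Coates–Sujatha's (A) at `p = 5` for EVERY elliptic curve over `ℚ` with a rational point of order `5` — FACT-FREE**
(a non-zero `Γ_ℚ`-fixed `Q ∈ W[5](ℚ̄)`; `h(ℚ(μ_5)) = 1`, Mathlib `five_pid`). [cite: CoatesSujatha2005, Cor. 3.6]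
[cite: Greenberg2001IwasawaPastPresent, p. 342] [cite: SilvermanAEC2009, Prop. III.8.1] -/
theorem fineSelmerDual_moduleFinite_five_of_fixed_point
    (W : WeierstrassCurve ℚ) [W.IsElliptic] [Fact (5 : ℕ).Prime]
    (Q : W.geomTorsion ((5 : ℕ) : ℤ)) (hQ0 : Q ≠ 0) (hQfix : ∀ σ : absoluteGaloisGroup ℚ, σ • Q = Q)
    (κ : ZpExtension ℚ 5) (hκ : κ.IsCyclotomic) :
    ∃ (γ : Field.absoluteGaloisGroup ℚ) (D : W.FineSelmerDualData κ γ),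
      Module.Finite ℤ_[5] (RestrictScalars ℤ_[5] (IwasawaAlgebra 5) D.X) := by
  obtain ⟨C, h1, h2, hfix⟩ := exists_fixed_line_of_fixed_point W Q hQ0 hQfix
  exact fineSelmerDual_moduleFinite_five_of_fixed_line W κ hκ C h1 h2 hfix

/-- **(A) at an odd prime `p` with `p ∤ h(ℚ(μ_p))` for every `E/ℚ` with a rational point of order `p`** (a non-zero
`Γ_ℚ`-fixed `Q ∈ W[p](ℚ̄)`; regularity displayed on a chosen `p`-th cyclotomic `L ⊆ ℚ̄`; by Mazur `p ≤ 7`, so beyond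
`3, 5` this is the `p = 7` family, `h(ℚ(μ_7)) = 1` not yet in Mathlib). [cite: CoatesSujatha2005, Cor. 3.6]
[cite: Greenberg2001IwasawaPastPresent, p. 342] [cite: SilvermanAEC2009, Prop. III.8.1] -/
theorem fineSelmerDual_moduleFinite_of_fixed_point
    (W : WeierstrassCurve ℚ) [W.IsElliptic] (p : ℕ) [Fact p.Prime] (hp : p ≠ 2)
    (Q : W.geomTorsion (p : ℤ)) (hQ0 : Q ≠ 0) (hQfix : ∀ σ : absoluteGaloisGroup ℚ, σ • Q = Q)
    (κ : ZpExtension ℚ p) (hκ : κ.IsCyclotomic)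
    (L : IntermediateField ℚ (AlgebraicClosure ℚ)) [IsCyclotomicExtension {p} ℚ L]
    (hreg : ¬ p ∣ Nat.card (ClassGroup (𝓞 L))) :
    ∃ (γ : Field.absoluteGaloisGroup ℚ) (D : W.FineSelmerDualData κ γ),
      Module.Finite ℤ_[p] (RestrictScalars ℤ_[p] (IwasawaAlgebra p) D.X) := by
  obtain ⟨C, h1, h2, hfix⟩ := exists_fixed_line_of_fixed_point W Q hQ0 hQfix
  exact fineSelmerDual_moduleFinite_of_fixed_line W p hp κ hκ C h1 h2 hfix L hreg

/-! ## §3 Crux M's core package per pin at a rational-`3`-torsion row: Kato's inputs and NOTHING ELSE -/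

/-- **Per pin at a row `(W, 3)` with a rational point of order `3` (a non-zero `Γ_ℚ`-fixed `Q ∈ W[3](ℚ̄)`), Kato's core
package `MemberHullZetaCoreInputs` from the hull sub-package `Z` (Fine) and H2X⁺'s `(J, e_X, count)` — NO Ferrero–Washington,
NO Lim, NO char-form fact, NO Imai, no class number.**
[cite: Kato2004Asterisque, Thm. 12.5 (3) (p. 222), (14.9.1) (p. 239), §14.14 (14.14.1)–(14.14.2) (p. 243)]
[cite: CoatesSujatha2005, Cor. 3.6] -/
theorem nonempty_coreInputs_of_fineInputs_three_of_fixed_point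
    (W : WeierstrassCurve ℚ) [W.IsElliptic] [Fact (3 : ℕ).Prime] [ContinuousSMul ℤ_[3] (W.tateModule 3)]
    (Q : W.geomTorsion ((3 : ℕ) : ℤ)) (hQ0 : Q ≠ 0) (hQfix : ∀ σ : absoluteGaloisGroup ℚ, σ • Q = Q)
    {κ : ZpExtension ℚ 3} (hκ : κ.IsCyclotomic) {γ : absoluteGaloisGroup ℚ} (hγ : κ.IsTopGenerator γ)
    {I : IwasawaH1Data W 3 κ γ} {y : I.H} (Z : MemberHullZetaFineInputs W 3 κ γ hγ I y)
    (J : IwasawaH2Data W 3 κ γ I)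
    (eX : (W.fineSelmerDualData κ hγ).X →ₗ[IwasawaAlgebra 3] J.H2) (heX : Function.Injective eX)
    (hcokX : Finite (J.H2 ⧸ LinearMap.range eX)) (hcount : KatoH2CountAt W 3 (Nat.card (coinvariants 3 J.H2))) :
    Nonempty (MemberHullZetaCoreInputs W 3 κ γ I y) :=
  FineInputsCharForm.nonempty_coreInputs_of_fineInputs_of_moduleFinite W 3
    (fineSelmerDual_moduleFinite_three_of_fixed_point W Q hQ0 hQfix κ hκ) hγ Z J eX heX hcokX hcount

end Summit.BirchSwinnertonDyer.BirchSwinnertonDyer.Theorems.ReducibleFineSelmerRationalTorsion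

end
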